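import Literature.NumberTheory.EllipticCurves.FormalGroupQuasiPeriodAdditionProofs
import Literature.NumberTheory.EllipticCurves.FormalGroupChordFormulaUniversalProofs
import Mathlib.Algebra.Algebra.Rat
import HarnessLib

/-!
# The pseudo-addition theorem for the quasi-period function `η₀` over every `ℚ`-algebra:
# discharge of `WeierstrassCurve.formalQuasiPeriod_addition` (proofs only)

Topic `Literature/NumberTheory/EllipticCurves`; third proof file behind the named fact
`WeierstrassCurve.formalQuasiPeriod_addition` (`FormalGroupQuasiPeriod`): for every Weierstrass equation `V`
over every `ℚ`-algebra `A`, in `A⟦u, v⟧`,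

  `u·v·N·F·C₀ = u·v·N - (u + v)·N·F - M·F`,

`C₀ = η₀(u +_F v) - η₀(u) - η₀(v)` the addition cocycle of the quasi-period function, `N = X(u)v² - X(v)u²`,
`M = X(v)u³ - X(u)v³` (Whittaker–Watson §20·41, `ζ(u+v) - ζ(u) - ζ(v) = ½(℘'(u) - ℘'(v))/(℘(u) - ℘(v))`, on the
formal group). Assembly of

* `formalQuasiPeriodCocycle_mul_eq_of_chord` (`FormalGroupQuasiPeriodAdditionProofs`: the theorem over a
  `ℚ`-algebra DOMAIN granted the chord formula for `x(u +_F v)`), and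
* `formalXMulSq_formalGroupLaw_chord'` (`FormalGroupChordFormulaUniversalProofs`: the chord formula over every
  commutative ring),

first over domains (`formalQuasiPeriodCocycle_mul_eq`), then over every `ℚ`-algebra by specialising the identity for
the universal equation over `ℚ[a₁, …, a₆]` (a domain) along `ℚ[aᵢ] → A` — `η₀` and `C₀` commute with homomorphisms
of `ℚ`-algebras (`map_formalQuasiPeriod`, `map_formalQuasiPeriodCocycle`).

BSD context: crux K★ `stmt-BirchSwinnertonDyer-22226`, hDR sector (iii), the `η`-period of the Weierstrass formal
group (the cocycle identity is what makes `∫_t η = lim pⁿη₀(ûₙ)` converge, Colmez 1992 §2); BSD is not proved by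
any of this.

## References
* E. T. Whittaker, G. N. Watson, *A Course of Modern Analysis* (1927), §20·41. [WhittakerWatson1927]
* J. H. Silverman, *The Arithmetic of Elliptic Curves* (2009), III.2.3, IV.1. [SilvermanAEC2009]
* N. M. Katz, *Crystalline cohomology, Dieudonné modules, and Jacobi sums* (1981), §5.1.
  [Katz1981CrystallineDieudonne]
-/

noncomputable section

open PowerSeries Literature.NumberTheory.EllipticCurves

namespace WeierstrassCurve

/-! ### `η₀` and `C₀` commute with homomorphisms of `ℚ`-algebras -/

section Map

variable {A B : Type*} [CommRing A] [Algebra ℚ A] [CommRing B] [Algebra ℚ B] (V : WeierstrassCurve A)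
  (φ : A →+* B)

/-- `η₀` commutes with base change along a homomorphism of `ℚ`-algebras (its coefficients are
`coeff n g_V / (n+1)` with `g_V` integral). [cite: Katz1981CrystallineDieudonne, §5.1] -/
theorem map_formalQuasiPeriod : PowerSeries.map φ V.formalQuasiPeriod = (V.map φ).formalQuasiPeriod := by
  ext n
  rw [coeff_map]
  rcases n with _ | n
  · rw [coeff_zero_eq_constantCoeff, constantCoeff_formalQuasiPeriod, coeff_zero_eq_constantCoeff,
      constantCoeff_formalQuasiPeriod, map_zero]
  · rw [coeff_succ_formalQuasiPeriod, coeff_succ_formalQuasiPeriod, map_mul, RingHom.map_rat_algebraMap,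
      ← V.map_formalQuasiPeriodIntegrand φ, coeff_map]

/-- The addition cocycle commutes with base change along a homomorphism of `ℚ`-algebras.
[cite: Katz1981CrystallineDieudonne, §5.1] -/
theorem map_formalQuasiPeriodCocycle :
    MvPowerSeries.map φ V.formalQuasiPeriodCocycle = (V.map φ).formalQuasiPeriodCocycle := by
  rw [formalQuasiPeriodCocycle_def, formalQuasiPeriodCocycle_def, map_sub, map_sub,
    PowerSeries.map_subst V.hasSubst_formalGroupLaw, PowerSeries.map_subst (PowerSeries.HasSubst.X 0),
    PowerSeries.map_subst (PowerSeries.HasSubst.X 1), map_formalQuasiPeriod, map_formalGroupLaw,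
    MvPowerSeries.map_X, MvPowerSeries.map_X]

/-- Both sides of the pseudo-addition identity commute with base change. [cite: WhittakerWatson1927, §20.41] -/
theorem map_formalQuasiPeriod_addition_sides :
    MvPowerSeries.map φ ((MvPowerSeries.X 0 : MvPowerSeries (Fin 2) A) * MvPowerSeries.X 1 *
        (V.formalXMulSq.subst (MvPowerSeries.X 0 : MvPowerSeries (Fin 2) A) * (MvPowerSeries.X 1) ^ 2 -
          V.formalXMulSq.subst (MvPowerSeries.X 1 : MvPowerSeries (Fin 2) A) * (MvPowerSeries.X 0) ^ 2) *
        V.formalGroupLaw * V.formalQuasiPeriodCocycle) =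
      (MvPowerSeries.X 0 : MvPowerSeries (Fin 2) B) * MvPowerSeries.X 1 *
        ((V.map φ).formalXMulSq.subst (MvPowerSeries.X 0 : MvPowerSeries (Fin 2) B) * (MvPowerSeries.X 1) ^ 2 -
          (V.map φ).formalXMulSq.subst (MvPowerSeries.X 1 : MvPowerSeries (Fin 2) B) * (MvPowerSeries.X 0) ^ 2) *
        (V.map φ).formalGroupLaw * (V.map φ).formalQuasiPeriodCocycle ∧
    MvPowerSeries.map φ ((MvPowerSeries.X 0 : MvPowerSeries (Fin 2) A) * MvPowerSeries.X 1 *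
          (V.formalXMulSq.subst (MvPowerSeries.X 0 : MvPowerSeries (Fin 2) A) * (MvPowerSeries.X 1) ^ 2 -
          V.formalXMulSq.subst (MvPowerSeries.X 1 : MvPowerSeries (Fin 2) A) * (MvPowerSeries.X 0) ^ 2) -
        (MvPowerSeries.X 0 + MvPowerSeries.X 1) *
          (V.formalXMulSq.subst (MvPowerSeries.X 0 : MvPowerSeries (Fin 2) A) * (MvPowerSeries.X 1) ^ 2 -
          V.formalXMulSq.subst (MvPowerSeries.X 1 : MvPowerSeries (Fin 2) A) * (MvPowerSeries.X 0) ^ 2) * V.formalGroupLaw -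
        (V.formalXMulSq.subst (MvPowerSeries.X 1 : MvPowerSeries (Fin 2) A) * (MvPowerSeries.X 0) ^ 3 -
            V.formalXMulSq.subst (MvPowerSeries.X 0 : MvPowerSeries (Fin 2) A) * (MvPowerSeries.X 1) ^ 3) * V.formalGroupLaw) =
      (MvPowerSeries.X 0 : MvPowerSeries (Fin 2) B) * MvPowerSeries.X 1 *
          ((V.map φ).formalXMulSq.subst (MvPowerSeries.X 0 : MvPowerSeries (Fin 2) B) * (MvPowerSeries.X 1) ^ 2 -
          (V.map φ).formalXMulSq.subst (MvPowerSeries.X 1 : MvPowerSeries (Fin 2) B) * (MvPowerSeries.X 0) ^ 2) -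
        (MvPowerSeries.X 0 + MvPowerSeries.X 1) *
          ((V.map φ).formalXMulSq.subst (MvPowerSeries.X 0 : MvPowerSeries (Fin 2) B) * (MvPowerSeries.X 1) ^ 2 -
          (V.map φ).formalXMulSq.subst (MvPowerSeries.X 1 : MvPowerSeries (Fin 2) B) * (MvPowerSeries.X 0) ^ 2) * (V.map φ).formalGroupLaw -
        ((V.map φ).formalXMulSq.subst (MvPowerSeries.X 1 : MvPowerSeries (Fin 2) B) * (MvPowerSeries.X 0) ^ 3 -
            (V.map φ).formalXMulSq.subst (MvPowerSeries.X 0 : MvPowerSeries (Fin 2) B) * (MvPowerSeries.X 1) ^ 3) * (V.map φ).formalGroupLaw := by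
  constructor <;>
  simp only [map_mul, map_pow, map_add, map_sub, MvPowerSeries.map_X,
    PowerSeries.map_subst (PowerSeries.HasSubst.X _), map_formalXMulSq, map_formalGroupLaw,
    map_formalQuasiPeriodCocycle]

end Map

/-! ### Over a domain, unconditionally -/

section Domain

variable {A : Type*} [CommRing A] [IsDomain A] [Algebra ℚ A] (V : WeierstrassCurve A)

/-- **The pseudo-addition theorem for `η₀` over a `ℚ`-algebra domain**, unconditionally:
`u·v·N·F·C₀ = u·v·N - (u+v)·N·F - M·F` (the chord formula is the tree theorem
`formalXMulSq_formalGroupLaw_chord'`). [cite: WhittakerWatson1927, §20.41] -/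
theorem formalQuasiPeriodCocycle_mul_eq :
    (MvPowerSeries.X 0 : MvPowerSeries (Fin 2) A) * MvPowerSeries.X 1 *
        (V.formalXMulSq.subst (MvPowerSeries.X 0 : MvPowerSeries (Fin 2) A) * (MvPowerSeries.X 1) ^ 2 -
          V.formalXMulSq.subst (MvPowerSeries.X 1 : MvPowerSeries (Fin 2) A) * (MvPowerSeries.X 0) ^ 2) *
        V.formalGroupLaw * V.formalQuasiPeriodCocycle =
      (MvPowerSeries.X 0 : MvPowerSeries (Fin 2) A) * MvPowerSeries.X 1 *
          (V.formalXMulSq.subst (MvPowerSeries.X 0 : MvPowerSeries (Fin 2) A) * (MvPowerSeries.X 1) ^ 2 -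
          V.formalXMulSq.subst (MvPowerSeries.X 1 : MvPowerSeries (Fin 2) A) * (MvPowerSeries.X 0) ^ 2) -
        (MvPowerSeries.X 0 + MvPowerSeries.X 1) *
          (V.formalXMulSq.subst (MvPowerSeries.X 0 : MvPowerSeries (Fin 2) A) * (MvPowerSeries.X 1) ^ 2 -
          V.formalXMulSq.subst (MvPowerSeries.X 1 : MvPowerSeries (Fin 2) A) * (MvPowerSeries.X 0) ^ 2) * V.formalGroupLaw -
        (V.formalXMulSq.subst (MvPowerSeries.X 1 : MvPowerSeries (Fin 2) A) * (MvPowerSeries.X 0) ^ 3 -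
            V.formalXMulSq.subst (MvPowerSeries.X 0 : MvPowerSeries (Fin 2) A) * (MvPowerSeries.X 1) ^ 3) * V.formalGroupLaw :=
  V.formalQuasiPeriodCocycle_mul_eq_of_chord V.formalXMulSq_formalGroupLaw_chord'

end Domain

/-! ### Over every `ℚ`-algebra: the named fact -/

section Universal

variable {A : Type*} [CommRing A] [Algebra ℚ A] (V : WeierstrassCurve A)

/-- `V` is the specialisation of the universal equation over `ℚ[aᵢ]` along the evaluation
`ℚ[a₁, …, a₆] → A` at its coefficients. [folklore] -/
private theorem universalRat_map :
    (universalInt.map (MvPolynomial.map (Int.castRingHom ℚ))).map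
        (MvPolynomial.eval₂Hom (algebraMap ℚ A) ![V.a₁, V.a₂, V.a₃, V.a₄, V.a₆]) = V := by
  ext <;> simp [universalInt, WeierstrassCurve.map]

/-- **The pseudo-addition theorem for the quasi-period function over every `ℚ`-algebra** — discharge of
the named fact `WeierstrassCurve.formalQuasiPeriod_addition`: the identity for the universal equation over
the domain `ℚ[a₁, …, a₆]` (`formalQuasiPeriodCocycle_mul_eq`), specialised along `ℚ[aᵢ] → A`.
[cite: WhittakerWatson1927, §20.41] -/
theorem formalQuasiPeriod_addition_holds : formalQuasiPeriod_addition := by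
  intro A _ _ V
  have hU := (universalInt.map (MvPolynomial.map (Int.castRingHom ℚ))).formalQuasiPeriodCocycle_mul_eq
  have h := congrArg (MvPowerSeries.map
    (MvPolynomial.eval₂Hom (algebraMap ℚ A) ![V.a₁, V.a₂, V.a₃, V.a₄, V.a₆])) hU
  obtain ⟨hl, hr⟩ :=
    (universalInt.map (MvPolynomial.map (Int.castRingHom ℚ))).map_formalQuasiPeriod_addition_sides
      (MvPolynomial.eval₂Hom (algebraMap ℚ A) ![V.a₁, V.a₂, V.a₃, V.a₄, V.a₆])
  rw [hl, hr, universalRat_map] at h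
  exact h

end Universal

end WeierstrassCurve
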